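import Mathlib
import HarnessLib
import Summits.ResolutionOfSingularities.ResolutionOfSingularities.Theorems.WildQuotientsWildQuotientResolutionS1aSymMember
import Summits.ResolutionOfSingularities.ResolutionOfSingularities.Theorems.WildQuotientsWildQuotientResolutionS1aNodePowerChains

/-!
# S1a — THE SECOND MEMBER TYPE of the class `L_d`: the component of the σ-INVARIANT LINE, a principal centre `(X₀′ : 1, φ : 1; shift 1, β = s^δ)`

[OURS · L1 W4.5c · lead-1 g15; R3 (`lines_killsIn_two`, plan-1 RULING R-F15l (2)): the line-arrangement tail `∏ ℓᵢ(x₁,x₂)` may contain the σ-invariant line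
`ℓ = a(x₁ − x₂)` (`ℓ(1,1) = 0`); on its chart the component element `φ = ℓ(x′)` is `τ`-FIXED, so the member ✓`exists_isPrincipalCentre_of_symMemberK1` (weights (2,1),
needs `τφ = φ + c·s^δX₀` with `c ≠ 0`) does not apply. Here: weights (1,1) — (a′)₁ holds BECAUSE `τφ = φ`; isolation and the `X₀`-chain come from the ROW OF `X₁`
(`τX₁ = X₁ + c₁·s^δX₀`, `c₁ ≠ 0`) instead of the row of `φ`] — NOT statements of the manuscript; counted 0; AI-level work, weaker than expert review. Crux
stmt-ResolutionOfSingularities-17941 `CyclicQuotientFourfolds`, line `s1a-logminvertex` v13 (`stub_reachLowerInFX`).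

* `Sym.symInv_admissible` ((a′)₁ for `(X₀ : 1, φ : 1)`, `β = s^δ`, from `τφ = φ`), `Sym.symInv_isolation` (`(X₀, φ) ≤ (aug τ : β)` from `c₁ ≠ 0`, `H` a unit),
  `Sym.symInv_chains` (power chains: `u = X₁` for `X₀` with unit `c₁`, `u = x₃` for `φ` with unit `H`);
* ★★★ `exists_isPrincipalCentre_of_symMemberInv` — abstract model `Φ : DW.B ≃ P`, K1′ of `(X₀, φ)` supplied, a GIVEN Veronese degree for the weights (1,1) and
  separating sections ⇒ a PRINCIPAL centre of that degree with `W` a principal-centre chart, `supp ⊆ W`, `supp` disjoint from the separating opens, trace formula.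
-/

set_option linter.dupNamespace false

noncomputable section

open CategoryTheory Limits AlgebraicGeometry TopologicalSpace Topology Opposite
open Literature.AlgebraicGeometry.Resolution Literature.AlgebraicGeometry.RelativeSpec
open MvPolynomial
open Summit.ResolutionOfSingularities.ResolutionOfSingularities.Theorems.WildQuotientResolution.S1
open Summit.ResolutionOfSingularities.ResolutionOfSingularities.Theorems.WildQuotientResolution.S1.NodeAtlas
open Summit.ResolutionOfSingularities.ResolutionOfSingularities.Theorems.WildQuotientResolution.S1.ProducerStep
open Summit.ResolutionOfSingularities.ResolutionOfSingularities.Theorems.WildQuotientResolution.S1.CoarseChart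
open Summit.ResolutionOfSingularities.ResolutionOfSingularities.Theorems.WildQuotientResolution.S1.GoodCharts
open Summit.ResolutionOfSingularities.ResolutionOfSingularities.Theorems.WildQuotientResolution.S1.NodeTransport
open Summit.ResolutionOfSingularities.ResolutionOfSingularities.Theorems.WildQuotientResolution.S1.NpFrame
open Summit.ResolutionOfSingularities.ResolutionOfSingularities.Theorems.WildQuotientResolution.S1.KillCert
open Summit.ResolutionOfSingularities.ResolutionOfSingularities.Theorems.WildQuotientResolution.S1.BlowupCharts

/-! ## Pure algebra: (a′)₁, isolation and power chains for the invariant component -/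

namespace Summit.ResolutionOfSingularities.ResolutionOfSingularities.Theorems.WildQuotientResolution.S1.KillCert.Sym

variable {k : Type} [Field k] {L : Type} [CommRing L] [Algebra k L] (τ : L ≃+* L) (s X₀ X₁ X₂ x₃ φ T H : L) (c₁ c₂ : k) (δ : ℕ) (Gfix : Set L)
  (hs : τ s = s) (hX₀ : τ X₀ = X₀) (hX₁ : τ X₁ = X₁ + algebraMap k L c₁ * (s ^ δ * X₀)) (hX₂ : τ X₂ = X₂ + algebraMap k L c₂ * (s ^ δ * X₀))
  (hx₃ : τ x₃ = x₃ + s ^ δ * T) (hφ : τ φ = φ) (hXR : T = H * φ)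
  (hfix : ∀ g ∈ Gfix, τ g = g) (hgen : Subring.closure (({s, X₀, X₁, X₂, x₃} : Set L) ∪ Gfix) = ⊤)

include hs hX₀ hX₁ hX₂ hx₃ hφ hXR hfix hgen in
/-- **(a′)₁ for the invariant member** `(X₀ : 1, φ : 1)`, `β = s^δ`: `y ∈ 𝒥ₙ ⇒ τy − y ∈ (s^δ)·𝒥ₙ₊₁` (uses `τφ = φ`). [OURS · L1 W4.5c · R3 second member type] -/
theorem symInv_admissible : ∀ (n : ℕ) (y : L), y ∈ (weightedFiltration (![X₀, φ] : Fin 2 → L) ![1, 1]).ideal n →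
    τ y - y ∈ Ideal.span {s ^ δ} * (weightedFiltration (![X₀, φ] : Fin 2 → L) ![1, 1]).ideal (n + 1) := by
  have hJ0 : X₀ ∈ (weightedFiltration (![X₀, φ] : Fin 2 → L) ![1, 1]).ideal 1 := mem_weightedFiltration_ideal (![X₀, φ] : Fin 2 → L) ![1, 1] 0
  have hJ1 : φ ∈ (weightedFiltration (![X₀, φ] : Fin 2 → L) ![1, 1]).ideal 1 := mem_weightedFiltration_ideal (![X₀, φ] : Fin 2 → L) ![1, 1] 1
  have hsJ : ∀ {m : ℕ} {y : L}, y ∈ (weightedFiltration (![X₀, φ] : Fin 2 → L) ![1, 1]).ideal m →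
      s ^ δ * y ∈ Ideal.span {s ^ δ} * (weightedFiltration (![X₀, φ] : Fin 2 → L) ![1, 1]).ideal m :=
    fun hy => Ideal.mul_mem_mul (Ideal.mem_span_singleton_self _) hy
  have h0 : ∀ m : ℕ, (0 : L) ∈ Ideal.span {s ^ δ} * (weightedFiltration (![X₀, φ] : Fin 2 → L) ![1, 1]).ideal m := fun m => Ideal.zero_mem _
  refine admissible_shift_of_generators (![X₀, φ] : Fin 2 → L) ![1, 1] τ 1 (s ^ δ) _ hgen ?_ ?_
  · rintro g (hg | hg)
    · simp only [Set.mem_insert_iff, Set.mem_singleton_iff] at hg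
      rcases hg with rfl | rfl | rfl | rfl | rfl
      · rw [hs, sub_self]; exact h0 1
      · rw [hX₀, sub_self]; exact h0 1
      · rw [hX₁, add_sub_cancel_left, show algebraMap k L c₁ * (s ^ δ * X₀) = s ^ δ * (algebraMap k L c₁ * X₀) by ring]
        exact hsJ (Ideal.mul_mem_left _ _ hJ0)
      · rw [hX₂, add_sub_cancel_left, show algebraMap k L c₂ * (s ^ δ * X₀) = s ^ δ * (algebraMap k L c₂ * X₀) by ring]
        exact hsJ (Ideal.mul_mem_left _ _ hJ0)
      · rw [hx₃, add_sub_cancel_left, hXR]; exact hsJ (Ideal.mul_mem_left _ _ hJ1)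
    · rw [hfix g hg, sub_self]; exact h0 1
  · intro i
    fin_cases i
    · change τ X₀ - X₀ ∈ Ideal.span {s ^ δ} * (weightedFiltration (![X₀, φ] : Fin 2 → L) ![1, 1]).ideal (1 + 1)
      rw [hX₀, sub_self]; exact h0 2
    · change τ φ - φ ∈ Ideal.span {s ^ δ} * (weightedFiltration (![X₀, φ] : Fin 2 → L) ![1, 1]).ideal (1 + 1)
      rw [hφ, sub_self]; exact h0 2

include hs hX₀ hX₁ hX₂ hx₃ hφ hXR hfix hgen in
/-- **`τ`-stability** of the invariant member filtration. -/
theorem symInv_map_le : ∀ n : ℕ, ((weightedFiltration (![X₀, φ] : Fin 2 → L) ![1, 1]).ideal n).map (τ : L →+* L) ≤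
    (weightedFiltration (![X₀, φ] : Fin 2 → L) ![1, 1]).ideal n :=
  map_le_of_admissible_shift (![X₀, φ] : Fin 2 → L) ![1, 1] τ 1 (s ^ δ) (symInv_admissible τ s X₀ X₁ X₂ x₃ φ T H c₁ c₂ δ Gfix hs hX₀ hX₁ hX₂ hx₃ hφ hXR hfix hgen)

include hX₁ hx₃ hXR in
/-- **Isolation** `(X₀, φ) ≤ (aug τ : s^δ)`: `s^δX₀ = c₁⁻¹(τX₁ − X₁)` and `s^δφ = H⁻¹(τx₃ − x₃)`. [OURS · L1 W4.5c · R3 second member type] -/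
theorem symInv_isolation (hc₁ : c₁ ≠ 0) (hH : IsUnit H) :
    ∃ N : ℕ, Ideal.span (Set.range (![X₀, φ] : Fin 2 → L)) ^ N ≤ (augmentationIdeal τ).colon (Ideal.span {s ^ δ}) := by
  refine ⟨1, ?_⟩
  rw [pow_one, Ideal.span_le]
  rintro _ ⟨i, rfl⟩
  rw [SetLike.mem_coe, Ideal.mem_colon_span_singleton]
  fin_cases i
  · change X₀ * s ^ δ ∈ augmentationIdeal τ
    have hcu : algebraMap k L c₁⁻¹ * algebraMap k L c₁ = 1 := by rw [← map_mul, inv_mul_cancel₀ hc₁, map_one]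
    rw [show X₀ * s ^ δ = algebraMap k L c₁⁻¹ * (τ X₁ - X₁) by rw [hX₁, add_sub_cancel_left, ← mul_assoc, hcu, one_mul, mul_comm]]
    exact Ideal.mul_mem_left _ _ (sub_mem_augmentationIdeal τ X₁)
  · change φ * s ^ δ ∈ augmentationIdeal τ
    obtain ⟨Hu, hHu⟩ := hH
    have hx : τ x₃ - x₃ = s ^ δ * (H * φ) := by rw [hx₃, hXR]; ring
    have hx' : φ * s ^ δ = ↑Hu⁻¹ * (τ x₃ - x₃) := by
      rw [hx, ← hHu, mul_left_comm (↑Hu⁻¹ : L), Units.inv_mul_cancel_left, mul_comm]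
    rw [hx']
    exact Ideal.mul_mem_left _ _ (sub_mem_augmentationIdeal τ x₃)

include hX₁ hx₃ hXR in
/-- **Power chains**: for `X₀` (weight 1): `u = X₁`, unit `c₁`; for `φ` (weight 1): `u = x₃`, unit `H`. [OURS · L1 W4.5c · R3 second member type] -/
theorem symInv_chains (hc₁ : c₁ ≠ 0) (hH : IsUnit H) : ∀ i : Fin 2, ∃ (mm : ℕ) (u hunit : L), 0 < mm ∧ 1 ≤ mm * (![1, 1] : Fin 2 → ℕ) i ∧ IsUnit hunit ∧
    u ∈ (weightedFiltration (![X₀, φ] : Fin 2 → L) ![1, 1]).ideal (mm * (![1, 1] : Fin 2 → ℕ) i - 1) ∧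
    τ u - u - s ^ δ * hunit * (![X₀, φ] : Fin 2 → L) i ^ mm ∈ Ideal.span {s ^ δ} * (weightedFiltration (![X₀, φ] : Fin 2 → L) ![1, 1]).ideal (mm * (![1, 1] : Fin 2 → ℕ) i + 1) := by
  intro i
  fin_cases i
  · refine ⟨1, X₁, algebraMap k L c₁, one_pos, by norm_num, (IsUnit.mk0 c₁ hc₁).map _, ?_, ?_⟩
    · change X₁ ∈ (weightedFiltration (![X₀, φ] : Fin 2 → L) ![1, 1]).ideal 0
      exact (weightedFiltration (![X₀, φ] : Fin 2 → L) ![1, 1]).ideal_zero.symm ▸ Submodule.mem_top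
    · change τ X₁ - X₁ - s ^ δ * algebraMap k L c₁ * X₀ ^ 1 ∈ _
      rw [hX₁, show X₁ + algebraMap k L c₁ * (s ^ δ * X₀) - X₁ - s ^ δ * algebraMap k L c₁ * X₀ ^ 1 = 0 by ring]
      exact Ideal.zero_mem _
  · refine ⟨1, x₃, H, one_pos, by norm_num, hH, ?_, ?_⟩
    · change x₃ ∈ (weightedFiltration (![X₀, φ] : Fin 2 → L) ![1, 1]).ideal 0
      exact (weightedFiltration (![X₀, φ] : Fin 2 → L) ![1, 1]).ideal_zero.symm ▸ Submodule.mem_top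
    · change τ x₃ - x₃ - s ^ δ * H * φ ^ 1 ∈ _
      rw [hx₃, hXR, show x₃ + s ^ δ * (H * φ) - x₃ - s ^ δ * H * φ ^ 1 = 0 by ring]
      exact Ideal.zero_mem _

end Summit.ResolutionOfSingularities.ResolutionOfSingularities.Theorems.WildQuotientResolution.S1.KillCert.Sym

/-! ## The invariant member on a chart of a model (abstract model, K1′ supplied) -/

namespace Summit.ResolutionOfSingularities.ResolutionOfSingularities.Theorems.WildQuotientResolution.S1.GameFrame.GModel

variable {p : ℕ} {X' X₁ : Scheme.{0}} {q : X' ⟶ X₁} {G : Type} [Group G] {ρ : G →* Aut X'} {g₀ : G}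

set_option maxHeartbeats 1600000 in
/-- ★★★ **THE MEMBER OF THE PARALLEL KILL LEAF FOR THE σ-INVARIANT COMPONENT** (weights (1,1)). See the module docstring.
[OURS · L1 W4.5c · R3 second member type; NOT a statement of the manuscript] -/
theorem exists_isPrincipalCentre_of_symMemberInv [Finite G] (hG : ∀ g : G, g ∈ Subgroup.zpowers g₀) (M : GModel p q G ρ g₀)
    [M.V.IsSeparated] (W : M.act.StableAffineOpens) (DW : NodeData p M.act g₀ W)
    {k : Type} [Field k] {P : Type} [CommRing P] [Algebra k P] (Φ : letI := DW.instCommRing; DW.B ≃+* P)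
    (τ : P ≃+* P) (hτ : letI := DW.instCommRing; ∀ x, τ x = Φ (DW.σ (Φ.symm x)))
    (s X₀ X₁ X₂ x₃ φ T H : P) (c₁ c₂ : k) (δ : ℕ) (Gfix : Set P)
    (hs : τ s = s) (hX₀ : τ X₀ = X₀) (hX₁ : τ X₁ = X₁ + algebraMap k P c₁ * (s ^ δ * X₀)) (hX₂ : τ X₂ = X₂ + algebraMap k P c₂ * (s ^ δ * X₀))
    (hx₃ : τ x₃ = x₃ + s ^ δ * T) (hφ : τ φ = φ) (hc₁ : c₁ ≠ 0) (hXR : T = H * φ) (hH : IsUnit H)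
    (hfix : ∀ g ∈ Gfix, τ g = g) (hgen : Subring.closure (({s, X₀, X₁, X₂, x₃} : Set P) ∪ Gfix) = ⊤)
    (hK1 : RingTheory.Sequence.IsRegular P (List.ofFn (![X₀, φ] : Fin 2 → P))) (hK1' : IsRegularRing (P ⧸ Ideal.span (Set.range (![X₀, φ] : Fin 2 → P))))
    (θ₀ θ₁ : Π j : Fin DW.m, ZMod (DW.r j))
    (hX₀d : letI := DW.instCommRing; letI := DW.instGradedRing; X₀ ∈ mapGrading DW.𝒜 Φ θ₀)
    (hφd : letI := DW.instCommRing; letI := DW.instGradedRing; φ ∈ mapGrading DW.𝒜 Φ θ₁)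
    (d : ℕ) (hd : 0 < d)
    (hver : letI := DW.instCommRing; letI := DW.instGradedRing; letI := mapGradedRing DW.𝒜 Φ; VeroneseNormalised (mapGrading DW.𝒜 Φ) (![X₀, φ] : Fin 2 → P) ![1, 1] d)
    {κ : Type} (U : κ → M.V.Opens) (hcov : ∀ x : M.V, x ∈ W.1 ∨ ∃ i, x ∈ U i) (u : κ → Γ(M.V, W.1)) (nu : κ → ℕ) (hnu : ∀ i, 0 < nu i)
    (huJ : letI := DW.instCommRing; letI := DW.instGradedRing; ∀ i,
      Φ ((DW.e (u i) : ↥(DW.𝒜 0)) : DW.B) ∈ (weightedFiltration (![X₀, φ] : Fin 2 → P) ![1, 1]).ideal (nu i))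
    (huU : ∀ i, ∀ x ∈ W.1, x ∈ U i → x ∈ M.V.basicOpen (u i)) :
    letI := DW.instCommRing; letI := DW.instGradedRing; letI := mapGradedRing DW.𝒜 Φ
    ∃ J : ReesFiltration M.V, IsPrincipalCentre p M.act g₀ J d ∧ IsPrincipalCentreChart p M.act g₀ J d W ∧
      (((J.ideal d).support : Set M.V)) ⊆ (W.1 : Set M.V) ∧ (∀ i, Disjoint ((U i : Set M.V)) (((J.ideal d).support : Set M.V))) ∧
      ∀ n, (J.filtration ⟨W.1, DW.affine⟩).ideal n =
        ((traceFiltration (mapGrading DW.𝒜 Φ) (![X₀, φ] : Fin 2 → P) ![1, 1]).ideal n).comap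
          ((DW.e.trans (zeroRingEquiv DW.𝒜 Φ) : Γ(M.V, W.1) ≃+* ↥(mapGrading DW.𝒜 Φ 0)) : Γ(M.V, W.1) →+* ↥(mapGrading DW.𝒜 Φ 0)) := by
  classical
  letI := DW.instCommRing
  letI := DW.instGradedRing
  letI := mapGradedRing DW.𝒜 Φ
  have hτeq : (conj Φ DW.σ : P ≃+* P) = τ := RingEquiv.ext fun x => (hτ x).symm
  -- the algebra of the member
  have hadm := Sym.symInv_admissible τ s X₀ X₁ X₂ x₃ φ T H c₁ c₂ δ Gfix hs hX₀ hX₁ hX₂ hx₃ hφ hXR hfix hgen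
  have hiso := Sym.symInv_isolation τ s X₀ X₁ x₃ φ T H c₁ δ hX₁ hx₃ hXR hc₁ hH
  have hchain := Sym.symInv_chains τ s X₀ X₁ x₃ φ T H c₁ δ hX₁ hx₃ hXR hc₁ hH
  rw [← hτeq] at hadm hiso hchain
  have hJmem : ∀ i, ∃ n : ℕ, 0 < n ∧ u i ^ n ∈ (((traceFiltration (mapGrading DW.𝒜 Φ) (![X₀, φ] : Fin 2 → P) ![1, 1]).ideal d).comap
      ((DW.e.trans (zeroRingEquiv DW.𝒜 Φ) : Γ(M.V, W.1) ≃+* ↥(mapGrading DW.𝒜 Φ 0)) : Γ(M.V, W.1) →+* ↥(mapGrading DW.𝒜 Φ 0)) : Ideal Γ(M.V, W.1)) := by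
    intro i
    refine ⟨d, hd, ?_⟩
    change (DW.e.trans (zeroRingEquiv DW.𝒜 Φ)) (u i ^ d) ∈ (traceFiltration (mapGrading DW.𝒜 Φ) (![X₀, φ] : Fin 2 → P) ![1, 1]).ideal d
    rw [mem_traceFiltration_iff, map_pow, SetLike.GradeZero.coe_pow]
    change (Φ ((DW.e (u i) : ↥(DW.𝒜 0)) : DW.B)) ^ d ∈ _
    have h := Ideal.pow_mem_pow (huJ i) d
    have hle := Veronese.idealFiltration_pow_le (weightedFiltration (![X₀, φ] : Fin 2 → P) ![1, 1]) (nu i) d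
    exact (weightedFiltration (![X₀, φ] : Fin 2 → P) ![1, 1]).antitone (Nat.le_mul_of_pos_left d (hnu i)) (hle h)
  have hcl : closure (M.V.zeroLocus (U := W.1)
      ((((traceFiltration (mapGrading DW.𝒜 Φ) (![X₀, φ] : Fin 2 → P) ![1, 1]).ideal d).comap
          ((DW.e.trans (zeroRingEquiv DW.𝒜 Φ) : Γ(M.V, W.1) ≃+* ↥(mapGrading DW.𝒜 Φ 0)) : Γ(M.V, W.1) →+* ↥(mapGrading DW.𝒜 Φ 0)) :
        Ideal Γ(M.V, W.1)) : Set Γ(M.V, W.1)) ∩ (W.1 : Set M.V)) ⊆ (W.1 : Set M.V) :=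
    closure_zeroLocus_inter_subset_of_cover W.1 U hcov _ u (fun i => (hJmem i).imp fun n hn => ⟨hn.1, hn.2⟩) huU
  obtain ⟨J, hJ, hJW, hJsupp, hJfil⟩ := exists_isPrincipalCentre_of_nodePowerChains hG M W DW Φ two_pos (![X₀, φ] : Fin 2 → P) ![θ₀, θ₁] ![1, 1]
    (fun i => by fin_cases i <;> norm_num) (fun i => by fin_cases i <;> assumption) hK1 hK1' d hd hver (s ^ δ) 1 hadm hiso hchain hcl
  refine ⟨J, hJ, hJW, hJsupp.trans hcl, fun i => ?_, hJfil⟩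
  obtain ⟨n, hn, hnS⟩ := hJmem i
  exact Disjoint.mono_right hJsupp (disjoint_closure_zeroLocus_of_section W.1 (U i) _ (u i) hn hnS (huU i))

end Summit.ResolutionOfSingularities.ResolutionOfSingularities.Theorems.WildQuotientResolution.S1.GameFrame.GModel

end
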